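import Summits.BirchSwinnertonDyer.BirchSwinnertonDyer.Theorems.SignedLowerHalvesSmallImageLowerHalfBothSignsRttD2SeqJ3StrictCarrier
import Literature.NumberTheory.GaloisRepresentations.DecompositionGroupOfCompletion
import Literature.NumberTheory.GaloisRepresentations.FrobeniusGeneration
import Literature.NumberTheory.GaloisRepresentations.IntegralGaloisActionProofs
import HarnessLib

/-!
# Route `SignedLowerHalves`, crux L `SmallImageLowerHalfBothSigns` (stmt-BirchSwinnertonDyer-23599), line `rtt_w3` v21 → v22 — E2, junction row J2⁺
# (THE LOCAL PACKAGE, unramified half (L1)): FROBENIUS DEPLETION KILLS THE LOCALISATIONS AT THE DEPLETED PLACES OFF `P`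

INPUTS hand `bsd-inputs-honda-p1` g26 under LEAD `cruxlead-stmt-BirchSwinnertonDyer-23599` g12 (cell `bsd-ssimc`; BRIEF-E2 rev 6 §1 (L1), §2 «J2⁺ = THE LOCAL
PACKAGE», MEMO v22-design §3 stub S1 «∀ b : I.H, junctionE • b ∈ B′»); helper `--supports stmt-BirchSwinnertonDyer-23599`. THEOREMS ONLY: no definition, no named
fact, no instance, no `sorry`. HONEST FRAMING: this is the finite-level local Galois bookkeeping behind (L1) «`([γ_w] − u_w)` kills `H¹_ur(K_{n,w̃}, X_k)`»; E2, crux L,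
crux M and BSD remain OPEN and are proved for NO curve by any of this.

THE MATHEMATICS. Let `w ∉ P` be a finite place, `𝔓 = 𝔓₀` (`adicCompletionPrime K w`) the prime of `\bar ℤ_K` cut out by the chosen embedding `ι : K̄ → K̄_w`
(its decomposition group is the image of `Γ_{K_w}`, tree `decompositionSubgroup_adicCompletionPrime_eq_range`) and `φ ∈ Γ_K` an arithmetic Frobenius at `𝔓`. On honda's coefficients `X_k = (𝒪 ⊗ μ_{p^k} ⊗ θ′)^{N_P}` every `σ ∈ Γ_K` acts as the HONEST `𝒪`-scalar
`u(σ) = θ′(σ)·χ_cyc(σ)` (§1). A level class `y ∈ H¹(G_P(K_n), X_k)` is a class of the quotient `G_P`, so its cocycle `ỹ` dies on the inertia group `I_𝔓 ≤ N_P`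
(`w ∉ P`); since every `d ∈ D_𝔓 ∩ U_n` is `φ^m · i · u` with `i ∈ I_𝔓` and `u` in any prescribed open subgroup (Frobenius generation, tree
`exists_eq_frobenius_pow_mul_of_mem_decompositionSubgroup`), `ỹ(π(φ⁻¹ d φ)) = ỹ(π d)`, whence `(conj_φ ỹ)(π d) = φ · ỹ(π d) = u(φ) · ỹ(π d)` on the image
`res_w(U_{n,w}) ⊆ D_𝔓 ∩ U_n` of the local group: **`loc_w (conj_φ y) = loc_w (u(φ) • y)` at every finite level** (§2). Reading `(1+T)^x ∈ Λ_𝒪` as `conj_φ`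
levelwise (§3, the one-variable twin of `JohnsonLeungKings2011.IwasawaCohomologyDataO.proj_groupEltO_smul_eq_layerConjO`) this says that the FROBENIUS DEPLETION
FACTOR `P_w = (1+T)^{x_w} − C u(φ_w)` kills `loc_w ∘ conj_δ` of every level component of every `b ∈ 𝐇¹ = I.H`, and hence (§4) for a finite set `T` of places
off `P` the product `∏_{w ∈ T} P_w` maps `I.H` into -w3's strict carrier `strictCarrier I (strictLevel S κ θ′ P S₀)` for every `S₀ ⊆ T`.
NOT here: the places of `S₀K ∩ P` (ramified for `θ′`; (L2) of the BRIEF), the non-vanishing / Euler-factor identity of the depletion, the λ-count.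

References: [NeukirchSchmidtWingberg2008] I §5 Prop. 1.5.3, (8.6.2)–(8.6.3); [NeukirchANT1999] I §9 (9.4)–(9.6), II §9 (9.6); [SerreLocalFields1979] VII §5;
[PerrinRiou1994Invent] §1.3; [Rubin2000] App. B.3; [JohnsonLeungKings2011] §4.1–4.2.
-/

set_option autoImplicit false
set_option linter.dupNamespace false -- D-0017: single-problem summit, the namespace repeats the problem name by design
noncomputable section

open scoped Classical
open NumberField IsDedekindDomain Field CategoryTheory PowerSeries

namespace Summit.BirchSwinnertonDyer.BirchSwinnertonDyer.Theorems.SmallImageRttJunctionLocal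

open Literature.NumberTheory.EllipticCurves Literature.NumberTheory.GaloisRepresentations
  Literature.NumberTheory.GaloisRepresentations.DiscreteGaloisModule
  Literature.NumberTheory.ComplexMultiplication.EllipticUnits
  Literature.NumberTheory.ComplexMultiplication.EllipticUnits.JohnsonLeungKings2011
  Summit.BirchSwinnertonDyer.BirchSwinnertonDyer.Theorems.SmallImageRttD2J1
  Summit.BirchSwinnertonDyer.BirchSwinnertonDyer.Theorems.SmallImageRttD2Seq
  IsDedekindDomain.HeightOneSpectrum

/-! ## §1. Every `σ ∈ Γ_K` acts on `𝒪 ⊗ μ_{p^k} ⊗ θ` as the `𝒪`-scalar `θ(σ) · χ_cyc(σ)` -/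

section Scalar

variable {K : Type} [Field K] [NumberField K] {p : ℕ} [Fact p.Prime] (S : Set (PadicAlgCl p))
  (θ : absoluteGaloisGroup K →ₜ* (padicCoeffIntegers S)ˣ)

omit [NumberField K] [Fact p.Prime] in
/-- `p^k` kills `μ_{p^k}`. [folklore] -/
theorem pow_smul_muCarrier_eq_zero (k : ℕ) (v : MuCarrier K (p ^ k)) : ((p : ℤ) ^ k) • v = 0 := by
  have h : ((p : ℤ) ^ k) • v = (p ^ k : ℕ) • v := by rw [← natCast_zsmul, Nat.cast_pow]
  rw [h]
  apply muVal_injective K (p ^ k)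
  rw [muVal_nsmul, muVal_pow_eq_one, muVal_zero]

/-- `σ ∈ Γ_K` acts on `μ_{p^k}(K̄)` as the integer `χ_cyc(σ) mod p^k` (Mathlib's `cyclotomicCharacter.spec`). [cite: SerreLocalFields1979, VII §5] -/
theorem mu_apply_eq_nsmul (k : ℕ) (σ : absoluteGaloisGroup K) (v : MuCarrier K (p ^ k)) :
    mu K (p ^ k) σ v = (PadicInt.toZModPow k ((GaloisRep.cyclotomicCharacter K p σ : ℤ_[p]ˣ) : ℤ_[p])).val • v := by
  haveI : NeZero (p : K) := ⟨Nat.cast_ne_zero.mpr (Fact.out : p.Prime).ne_zero⟩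
  apply muVal_injective K (p ^ k)
  have ht : ((muVal K (p ^ k) v : (AlgebraicClosure K)ˣ) : AlgebraicClosure K) ^ p ^ k = 1 := by
    rw [← Units.val_pow_eq_pow_val, muVal_pow_eq_one, Units.val_one]
  rw [muVal_apply, muVal_nsmul]
  ext
  rw [Units.coe_smul, GaloisRep.cyclotomicCharacter_spec K p σ _ ht, Units.val_pow_eq_pow_val]

/-- ★ **`σ` acts on `𝒪 ⊗ μ_{p^k} ⊗ θ` as the HONEST `𝒪`-scalar `u(σ) = θ(σ) · χ_cyc(σ)`** (read in `𝒪` through `ℤ_p → 𝒪`): `σ·(a ⊗ ζ) = θ(σ)a ⊗ ζ^{χ(σ)} =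
(χ(σ)θ(σ)a) ⊗ ζ`, and `χ(σ) ≡ χ(σ) mod p^k` on the `p^k`-torsion module. [cite: JohnsonLeungKings2011, §4.2 (arXiv p0012:L72–76)] [cite: SerreLocalFields1979, VII §5] -/
theorem muTwistO_eq_oMuScalar (k : ℕ) (σ : absoluteGaloisGroup K) (x : OMuCarrier K S (p ^ k)) :
    muTwistO S θ k σ x =
      oMuScalar S (p ^ k) (((θ σ : (padicCoeffIntegers S)ˣ) : padicCoeffIntegers S) *
        padicIntToCoeffIntegers S ((GaloisRep.cyclotomicCharacter K p σ : ℤ_[p]ˣ) : ℤ_[p])) x := by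
  set χ : ℤ_[p] := ((GaloisRep.cyclotomicCharacter K p σ : ℤ_[p]ˣ) : ℤ_[p]) with hχ
  -- `χ ≡ (χ mod p^k) (mod p^k)` in `ℤ_p`, pushed to `𝒪`
  obtain ⟨b, hb⟩ : ∃ b : ℤ_[p], χ - ((PadicInt.toZModPow k χ).val : ℤ_[p]) = (p : ℤ_[p]) ^ k * b := by
    have hmem : χ - ((PadicInt.toZModPow k χ).val : ℤ_[p]) ∈ RingHom.ker (PadicInt.toZModPow k : ℤ_[p] →+* ZMod (p ^ k)) := by
      rw [RingHom.mem_ker, map_sub, map_natCast, ZMod.natCast_zmod_val, sub_self]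
    rw [PadicInt.ker_toZModPow] at hmem
    obtain ⟨b, hb⟩ := Ideal.mem_span_singleton'.mp hmem
    exact ⟨b, by rw [← hb, mul_comm]⟩
  induction x using OMuCarrier.induction_on with
  | zero => rw [map_zero, map_zero]
  | tmul a v =>
    rw [muTwistO_tmul, oMuScalar_tmul, mu_apply_eq_nsmul]
    -- move the integer `c = χ mod p^k` across the tensor sign
    set c : ℕ := (PadicInt.toZModPow k χ).val with hc
    have h1 : OMuCarrier.tmul (((θ σ : (padicCoeffIntegers S)ˣ) : padicCoeffIntegers S) * a) (c • v) =
        OMuCarrier.tmul ((c : padicCoeffIntegers S) * (((θ σ : (padicCoeffIntegers S)ˣ) : padicCoeffIntegers S) * a)) v := by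
      change OMuCarrier.toTensor.symm (_ ⊗ₜ[ℤ] (c • v)) = OMuCarrier.toTensor.symm (_ ⊗ₜ[ℤ] v)
      rw [← natCast_zsmul, TensorProduct.tmul_smul, TensorProduct.smul_tmul', zsmul_eq_mul, Int.cast_natCast]
    rw [h1]
    -- the two scalars differ by `θ(σ)·p^k·b`, which kills `a ⊗ ζ`
    have h2 : ((θ σ : (padicCoeffIntegers S)ˣ) : padicCoeffIntegers S) * padicIntToCoeffIntegers S χ * a =
        (c : padicCoeffIntegers S) * (((θ σ : (padicCoeffIntegers S)ˣ) : padicCoeffIntegers S) * a) +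
          ((p : ℤ) ^ k) • (((θ σ : (padicCoeffIntegers S)ˣ) : padicCoeffIntegers S) * padicIntToCoeffIntegers S b * a) := by
      have hχ' : padicIntToCoeffIntegers S χ = (c : padicCoeffIntegers S) + (p : padicCoeffIntegers S) ^ k * padicIntToCoeffIntegers S b := by
        rw [← map_natCast (padicIntToCoeffIntegers S) c, ← map_natCast (padicIntToCoeffIntegers S) p, ← map_pow, ← map_mul, ← map_add,
          ← hb, add_sub_cancel]
      rw [hχ', zsmul_eq_mul, Int.cast_pow, Int.cast_natCast]
      ring
    rw [h2]
    change _ = OMuCarrier.toTensor.symm ((_ + _) ⊗ₜ[ℤ] v)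
    rw [TensorProduct.add_tmul, TensorProduct.smul_tmul, pow_smul_muCarrier_eq_zero, TensorProduct.tmul_zero, add_zero]
    rfl
  | add x y hx hy => rw [map_add, map_add, hx, hy]

end Scalar

/-! ## §2. At a place `w ∉ P` a Frobenius acts on the localisation of every level class as the scalar `u(φ) = θ′(φ)·χ_cyc(φ)` -/

section Frobenius

variable {K : Type} [Field K] [NumberField K] {p : ℕ} [Fact p.Prime] (S : Set (PadicAlgCl p)) (κ : ZpExtension K p)
  (θ' : absoluteGaloisGroup K →ₜ* (padicCoeffIntegers S)ˣ) (P : Set (HeightOneSpectrum (𝓞 K))) (w : HeightOneSpectrum (𝓞 K))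

/-- `loc_w ∘ conj_γ` on an explicit cocycle `c` of `H¹(G_P(K_n), X_k)`: the class of the cocycle `x ↦ γ · c(π(γ⁻¹ (res x) γ))` on `U_{n,w}`.
[cite: SerreLocalFields1979, VII §5] [cite: NeukirchSchmidtWingberg2008, I §5 Prop. 1.5.3] -/
theorem locNK_cycLayerConjO_oneCocycleClass (γ : absoluteGaloisGroup K) (n k : ℕ)
    (c : contOneCocycles (subgroupRep (coeffGSO S P θ' k).toTopRep (imGS P (κ.layerSubgroup n)))) :
    haveI : (imGS P (κ.layerSubgroup n)).Normal := normal_imGS P _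
    locNK S κ θ' P w n k (cycLayerConjO S κ θ' P n k 1 γ (oneCocycleClass (subgroupRep (coeffGSO S P θ' k).toTopRep (imGS P (κ.layerSubgroup n))) c)) =
      oneCocycleClass (subgroupRep (locCoeffRep S θ' P w k).toTopRep (localSubgroupOfEmb (κ.layerSubgroup n) (closureEmb (K := K) (w.adicCompletion K))))
        (contOneCocycles.pullback (locLayerHom κ P w n) (locLayerMod S κ θ' P w n k)
          (contOneCocycles.pullback (Literature.NumberTheory.EllipticCurves.subgroupConj (imGS P (κ.layerSubgroup n)) (toUnramifiedQuot K P γ))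
            (conjRepHom (coeffGSO S P θ' k).toTopRep (imGS P (κ.layerSubgroup n)) (toUnramifiedQuot K P γ)) c)) := by
  haveI : (imGS P (κ.layerSubgroup n)).Normal := normal_imGS P _
  rw [cycLayerConjO, levelConjO_apply, conjMap_oneCocycleClass, locNK_apply, map_oneCocycleClass]

/-- `loc_w ∘ H¹(F)` on an explicit cocycle `c` of `H¹(G_P(K_n), X_k)`, for any endomorphism `F` of the coefficients of the level: the class of `x ↦ F(c(π(res x)))` on
`U_{n,w}`. [cite: NeukirchSchmidtWingberg2008, I §5 Prop. 1.5.2] -/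
theorem locNK_map_id_oneCocycleClass (n k : ℕ)
    (F : TopRep.res ((ContinuousMonoidHom.id (imGS P (κ.layerSubgroup n)) : imGS P (κ.layerSubgroup n) →ₜ* imGS P (κ.layerSubgroup n)) :
        imGS P (κ.layerSubgroup n) →* imGS P (κ.layerSubgroup n)) (subgroupRep (coeffGSO S P θ' k).toTopRep (imGS P (κ.layerSubgroup n))) ⟶
      subgroupRep (coeffGSO S P θ' k).toTopRep (imGS P (κ.layerSubgroup n)))
    (c : contOneCocycles (subgroupRep (coeffGSO S P θ' k).toTopRep (imGS P (κ.layerSubgroup n)))) :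
    locNK S κ θ' P w n k (ContinuousCohomology.map (ContinuousMonoidHom.id _) F 1
        (oneCocycleClass (subgroupRep (coeffGSO S P θ' k).toTopRep (imGS P (κ.layerSubgroup n))) c)) =
      oneCocycleClass (subgroupRep (locCoeffRep S θ' P w k).toTopRep (localSubgroupOfEmb (κ.layerSubgroup n) (closureEmb (K := K) (w.adicCompletion K))))
        (contOneCocycles.pullback (locLayerHom κ P w n) (locLayerMod S κ θ' P w n k) (contOneCocycles.pullback (ContinuousMonoidHom.id _) F c)) := by
  rw [map_oneCocycleClass, locNK_apply, map_oneCocycleClass]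

omit [NumberField K] in
/-- honda's `𝒪`-scalar operator `H¹(a ⊗ id)` on the layer group IS Mathlib's `ContinuousCohomology.map` of the coefficient endomorphism `a ⊗ id` re-typed on the tree's
`subgroupRep` (definitional). [cite: JohnsonLeungKings2011, §4.1 Def. 4.1] -/
theorem cycLayerScalarO_eq_map (n k : ℕ) (a : padicCoeffIntegers S) (y : cycLayerCohO S κ θ' P n k 1) :
    cycLayerScalarO S κ θ' P n k 1 a y =
      ContinuousCohomology.map (ContinuousMonoidHom.id _)
        (TopRep.ofHom ⟨⟨coeffMapO S P θ' (oMuScalar S (p ^ k) a) (oMuScalar_muTwistO S θ' k a), continuous_of_discreteTopology⟩,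
            fun g ↦ ContinuousLinearMap.ext fun x ↦ Subtype.ext (by
              obtain ⟨g, hg⟩ := g
              obtain ⟨σ, rfl⟩ := QuotientGroup.mk_surjective g
              exact oMuScalar_muTwistO S θ' k a σ x.1)⟩ :
          TopRep.res ((ContinuousMonoidHom.id (imGS P (κ.layerSubgroup n)) : imGS P (κ.layerSubgroup n) →ₜ* imGS P (κ.layerSubgroup n)) :
            imGS P (κ.layerSubgroup n) →* imGS P (κ.layerSubgroup n)) (subgroupRep (coeffGSO S P θ' k).toTopRep (imGS P (κ.layerSubgroup n))) ⟶
          subgroupRep (coeffGSO S P θ' k).toTopRep (imGS P (κ.layerSubgroup n))) 1 y :=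
  rfl

/-- ★ **The cocycle of a level class is blind to Frobenius conjugation on the decomposition group.** For `w ∉ P` (so `I_𝔓 ≤ N_P ≤ U_n` for the prime
`𝔓 = 𝔓₀` above `w` cut out by `K̄ → K̄_w`), an arithmetic Frobenius `φ` at `𝔓` and a continuous cocycle `c` on `(U_n)_P = G_P(K_n)`: for every `x` in the local
group `U_{n,w}`, `c(π(φ⁻¹ · res x · φ)) = c(π(res x))`. Proof: `c` vanishes on an open normal subgroup `V ≤ U_n` of `Γ_K` (continuity, profiniteness); by Frobenius
generation `res x = φ^m · i · u` with `i ∈ I_𝔓`, `u ∈ V`, so both arguments are `π(φ^m) · π(element of V)` (as `π` kills `I_𝔓 ≤ N_P`), and the cocycle identity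
finishes. [cite: NeukirchANT1999, I §9 Prop. (9.4), II §9 Prop. (9.6)] [cite: SerreLocalFields1979, VII §5] -/
theorem apply_subgroupConj_locLayerHom_eq (hw : w ∉ P) (hNP : ∀ n, ramificationSubgroup K P ≤ κ.layerSubgroup n)
    {φ : absoluteGaloisGroup K} (hφ : IsArithFrobAt (𝓞 K) φ (adicCompletionPrime K w)) (n k : ℕ)
    (c : contOneCocycles (subgroupRep (coeffGSO S P θ' k).toTopRep (imGS P (κ.layerSubgroup n))))
    (x : localSubgroupOfEmb (κ.layerSubgroup n) (closureEmb (K := K) (w.adicCompletion K))) :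
    haveI : (imGS P (κ.layerSubgroup n)).Normal := normal_imGS P _
    c.1 (Literature.NumberTheory.EllipticCurves.subgroupConj (imGS P (κ.layerSubgroup n)) (toUnramifiedQuot K P φ) (locLayerHom κ P w n x)) =
      c.1 (locLayerHom κ P w n x) := by
  haveI : (imGS P (κ.layerSubgroup n)).Normal := normal_imGS P _
  have h𝔓 : adicCompletionPrime K w ∈ w.primesAbove := adicCompletionPrime_mem_primesAbove K w
  have hIN : (adicCompletionPrime K w).inertia (absoluteGaloisGroup K) ≤ ramificationSubgroup K P := inertia_le_ramificationSubgroup hw h𝔓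
  -- an open normal subgroup `V ≤ U_n` of `Γ_K` on which the cocycle vanishes
  have hcont : Continuous fun u : κ.layerSubgroup n ↦ c.1 ⟨toUnramifiedQuot K P u, Subgroup.mem_map_of_mem _ u.2⟩ :=
    c.1.continuous.comp (((continuous_toUnramifiedQuot K P).comp continuous_subtype_val).subtype_mk _)
  have hOopen : IsOpen (Subtype.val '' ((fun u : κ.layerSubgroup n ↦ c.1 ⟨toUnramifiedQuot K P u, Subgroup.mem_map_of_mem _ u.2⟩) ⁻¹' {0})) :=
    (κ.isOpen_layerSubgroup n).isOpenMap_subtype_val _ (hcont.isOpen_preimage _ (isOpen_discrete _))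
  have hO1 : (1 : absoluteGaloisGroup K) ∈
      Subtype.val '' ((fun u : κ.layerSubgroup n ↦ c.1 ⟨toUnramifiedQuot K P u, Subgroup.mem_map_of_mem _ u.2⟩) ⁻¹' {0}) := by
    refine ⟨1, ?_, rfl⟩
    rw [Set.mem_preimage, Set.mem_singleton_iff]
    have h1 : (⟨toUnramifiedQuot K P ((1 : κ.layerSubgroup n) : absoluteGaloisGroup K), Subgroup.mem_map_of_mem _ (1 : κ.layerSubgroup n).2⟩ :
        imGS P (κ.layerSubgroup n)) = 1 := Subtype.ext (map_one _)
    rw [h1]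
    exact contOneCocycles.apply_one c
  obtain ⟨V, hV⟩ := ProfiniteGrp.exist_openNormalSubgroup_sub_open_nhds_of_one hOopen hO1
  have hVU : ∀ u ∈ (V : Subgroup (absoluteGaloisGroup K)), u ∈ κ.layerSubgroup n := by
    intro u hu
    obtain ⟨u', -, rfl⟩ := hV hu
    exact u'.2
  have hVc : ∀ (u : absoluteGaloisGroup K) (hu : u ∈ (V : Subgroup (absoluteGaloisGroup K))) (h : toUnramifiedQuot K P u ∈ imGS P (κ.layerSubgroup n)),
      c.1 ⟨toUnramifiedQuot K P u, h⟩ = 0 := by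
    intro u hu h
    obtain ⟨u', hu', rfl⟩ := hV hu
    exact hu'
  -- the cocycle only depends on the underlying element of `G_P`
  have key : ∀ z z' : imGS P (κ.layerSubgroup n), (z : GaloisGroupUnramifiedOutside K P) = z' → c.1 z = c.1 z' :=
    fun z z' h ↦ by rw [Subtype.ext h]
  -- the global element `d = res x ∈ D_𝔓 ∩ U_n` and its Frobenius decomposition `d = φ^m · i · u` (`D_{𝔓₀}` is the image of `Γ_{K_w}`)
  have hdU : resGalOfEmb (closureEmb (K := K) (w.adicCompletion K)) (x : absoluteGaloisGroup (w.adicCompletion K)) ∈ κ.layerSubgroup n :=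
    (mem_localSubgroupOfEmb_iff _ _ _).mp x.2
  have hz : ((locLayerHom κ P w n x : imGS P (κ.layerSubgroup n)) : GaloisGroupUnramifiedOutside K P) =
      toUnramifiedQuot K P (resGalOfEmb (closureEmb (K := K) (w.adicCompletion K)) (x : absoluteGaloisGroup (w.adicCompletion K))) := by
    rw [locLayerHom_apply_coe, locGS_apply]
  have hgen := exists_eq_frobenius_pow_mul_of_mem_decompositionSubgroup (U := (V : Subgroup (absoluteGaloisGroup K)))
    (d := resGalOfEmb (closureEmb (K := K) (w.adicCompletion K)) (x : absoluteGaloisGroup (w.adicCompletion K))) h𝔓 hφ V.isOpen (by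
      rw [decompositionSubgroup_adicCompletionPrime_eq_range]
      exact ⟨(x : absoluteGaloisGroup (w.adicCompletion K)), rfl⟩)
  generalize resGalOfEmb (closureEmb (K := K) (w.adicCompletion K)) (x : absoluteGaloisGroup (w.adicCompletion K)) = d at hgen hdU hz
  obtain ⟨m, i, u, hi, hu, rfl⟩ := hgen
  have hiU : i ∈ κ.layerSubgroup n := hNP n (hIN hi)
  have huU : u ∈ κ.layerSubgroup n := hVU u hu
  have ht : φ ^ m ∈ κ.layerSubgroup n := by
    have h := (κ.layerSubgroup n).mul_mem hdU ((κ.layerSubgroup n).inv_mem ((κ.layerSubgroup n).mul_mem hiU huU))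
    simpa only [show φ ^ m * i * u * (i * u)⁻¹ = φ ^ m by group] using h
  have hu₂ : φ⁻¹ * u * φ ∈ (V : Subgroup (absoluteGaloisGroup K)) := by
    simpa only [inv_inv] using (inferInstance : (V : Subgroup (absoluteGaloisGroup K)).Normal).conj_mem u hu φ⁻¹
  have hπi : toUnramifiedQuot K P i = 1 := (QuotientGroup.eq_one_iff i).mpr (hIN hi)
  have hπi' : toUnramifiedQuot K P (φ⁻¹ * i * φ) = 1 :=
    (QuotientGroup.eq_one_iff _).mpr ((ramificationSubgroup_normal K P).conj_mem' i (hIN hi) φ)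
  -- both elements of `(U_n)_P` at which `c` gets evaluated are `π(φ^m) · π(element of V)`
  have q1 : (toUnramifiedQuot K P φ)⁻¹ * toUnramifiedQuot K P (φ ^ m * i * u) * toUnramifiedQuot K P φ =
      toUnramifiedQuot K P (φ ^ m) * toUnramifiedQuot K P (φ⁻¹ * u * φ) := by
    simp only [← map_inv, ← map_mul, show φ⁻¹ * (φ ^ m * i * u) * φ = φ ^ m * (φ⁻¹ * i * φ) * (φ⁻¹ * u * φ) by group]
    simp only [map_mul, hπi', mul_one]
  have q2 : toUnramifiedQuot K P (φ ^ m * i * u) = toUnramifiedQuot K P (φ ^ m) * toUnramifiedQuot K P u := by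
    simp only [map_mul, hπi, mul_one]
  have hz1 : ((Literature.NumberTheory.EllipticCurves.subgroupConj (imGS P (κ.layerSubgroup n)) (toUnramifiedQuot K P φ) (locLayerHom κ P w n x) :
      imGS P (κ.layerSubgroup n)) : GaloisGroupUnramifiedOutside K P) =
      ((⟨toUnramifiedQuot K P (φ ^ m), Subgroup.mem_map_of_mem _ ht⟩ * ⟨toUnramifiedQuot K P (φ⁻¹ * u * φ), Subgroup.mem_map_of_mem _ (hVU _ hu₂)⟩ :
        imGS P (κ.layerSubgroup n)) : GaloisGroupUnramifiedOutside K P) := by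
    simp only [Literature.NumberTheory.EllipticCurves.subgroupConj_apply_coe, hz, Subgroup.coe_mul, q1]
  have hz2 : ((locLayerHom κ P w n x : imGS P (κ.layerSubgroup n)) : GaloisGroupUnramifiedOutside K P) =
      ((⟨toUnramifiedQuot K P (φ ^ m), Subgroup.mem_map_of_mem _ ht⟩ * ⟨toUnramifiedQuot K P u, Subgroup.mem_map_of_mem _ huU⟩ :
        imGS P (κ.layerSubgroup n)) : GaloisGroupUnramifiedOutside K P) := by
    simp only [hz, Subgroup.coe_mul, q2]
  have E3 : c.1 ⟨toUnramifiedQuot K P (φ⁻¹ * u * φ), Subgroup.mem_map_of_mem _ (hVU _ hu₂)⟩ = 0 := hVc _ hu₂ _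
  have E4 : c.1 ⟨toUnramifiedQuot K P u, Subgroup.mem_map_of_mem _ huU⟩ = 0 := hVc _ hu _
  -- the cocycle identity `c(ab) = c(a) + a·c(b)` with `c(b) = 0`
  have E5 : c.1 ((⟨toUnramifiedQuot K P (φ ^ m), Subgroup.mem_map_of_mem _ ht⟩ : imGS P (κ.layerSubgroup n)) *
      ⟨toUnramifiedQuot K P (φ⁻¹ * u * φ), Subgroup.mem_map_of_mem _ (hVU _ hu₂)⟩) =
      c.1 ⟨toUnramifiedQuot K P (φ ^ m), Subgroup.mem_map_of_mem _ ht⟩ :=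
    (c.2 _ _).trans (by simp only [E3, map_zero, add_zero])
  have E6 : c.1 ((⟨toUnramifiedQuot K P (φ ^ m), Subgroup.mem_map_of_mem _ ht⟩ : imGS P (κ.layerSubgroup n)) *
      ⟨toUnramifiedQuot K P u, Subgroup.mem_map_of_mem _ huU⟩) =
      c.1 ⟨toUnramifiedQuot K P (φ ^ m), Subgroup.mem_map_of_mem _ ht⟩ :=
    (c.2 _ _).trans (by simp only [E4, map_zero, add_zero])
  exact ((key _ _ hz1).trans E5).trans ((key _ _ hz2).trans E6).symm

/-- ★★ **`loc_w (conj_φ y) = loc_w (u(φ) • y)` at every finite level `(n, k)`**, for a place `w ∉ P` (so the inertia group `I_𝔓` of the prime `𝔓 = 𝔓₀ = adicCompletionPrime K w` cut out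
by the chosen embedding `K̄ → K̄_w` lies in `N_P ≤ U_n = Gal(K̄/K_n)`), an arithmetic Frobenius `φ ∈ Γ_K` at `𝔓` and ANY class `y ∈ H¹(G_P(K_n), X_k)`: the localised cocycle is
unramified, and on `D_𝔓 ∩ U_n = φ^ℕ · I_𝔓 · V` (Frobenius generation) conjugation by `φ` only multiplies it by the scalar `u(φ) = θ′(φ)·χ_cyc(φ)` through which `φ`
acts on the coefficients. This is (L1) of the junction: `([γ_w] − u_w)` kills `H¹_ur(K_{n,w̃}, X_k)`, `u_w = N(w)·θ(Frob_w)⁻¹`.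
[cite: NeukirchSchmidtWingberg2008, I §5 Prop. 1.5.3, (8.6.2)] [cite: NeukirchANT1999, I §9 Prop. (9.4), II §9 Prop. (9.6)] [cite: SerreLocalFields1979, VII §5] -/
theorem locNK_cycLayerConjO_eq_locNK_cycLayerScalarO_of_isArithFrobAt (hw : w ∉ P) (hNP : ∀ n, ramificationSubgroup K P ≤ κ.layerSubgroup n)
    {φ : absoluteGaloisGroup K} (hφ : IsArithFrobAt (𝓞 K) φ (adicCompletionPrime K w)) (n k : ℕ) (y : cycLayerCohO S κ θ' P n k 1) :
    locNK S κ θ' P w n k (cycLayerConjO S κ θ' P n k 1 φ y) =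
      locNK S κ θ' P w n k (cycLayerScalarO S κ θ' P n k 1
        (((θ' φ : (padicCoeffIntegers S)ˣ) : padicCoeffIntegers S) *
          padicIntToCoeffIntegers S ((GaloisRep.cyclotomicCharacter K p φ : ℤ_[p]ˣ) : ℤ_[p])) y) := by
  haveI : (imGS P (κ.layerSubgroup n)).Normal := normal_imGS P _
  obtain ⟨c, rfl⟩ := oneCocycleClass_surjective (subgroupRep (coeffGSO S P θ' k).toTopRep (imGS P (κ.layerSubgroup n))) y
  rw [locNK_cycLayerConjO_oneCocycleClass, cycLayerScalarO_eq_map, locNK_map_id_oneCocycleClass]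
  congr 1
  refine Subtype.ext (ContinuousMap.ext fun x ↦ Subtype.ext ?_)
  change ((coeffGSO S P θ' k (toUnramifiedQuot K P φ)
      (c.1 (Literature.NumberTheory.EllipticCurves.subgroupConj (imGS P (κ.layerSubgroup n)) (toUnramifiedQuot K P φ) (locLayerHom κ P w n x))) : _) :
      OMuCarrier K S (p ^ k)) = oMuScalar S (p ^ k) _ ((c.1 (locLayerHom κ P w n x) : _) : OMuCarrier K S (p ^ k))
  rw [apply_subgroupConj_locLayerHom_eq S κ θ' P w hw hNP hφ n k c x, show toUnramifiedQuot K P φ = (φ : GaloisGroupUnramifiedOutside K P) from rfl,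
    quotientInvariants_apply_coe, muTwistO_eq_oMuScalar]

end Frobenius

end Summit.BirchSwinnertonDyer.BirchSwinnertonDyer.Theorems.SmallImageRttJunctionLocal

end
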